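import Literature.NumberTheory.LFunctions.Zhang2022.SkeletonSetting
import Literature.NumberTheory.LFunctions.SiegelTheorem
import Literature.NumberTheory.LFunctions.TatuzawaTheorem
import Literature.NumberTheory.LFunctions.RealZeroRepulsionOddSqrtClassNumber
import HarnessLib

/-!
# Route `PrimeLevelFamEdge` — TYPED IDEA DELTAS, deck 11: the `wuc` LADDER under the leaf (cell ls-idea,
# seat ls-idea-lens-13, LENSES-v3 `wuc`; card K-L13-1 «TWO RAILS», critics A b77 · B b78 (fixes (α)(β) in
# v1.1) · C b77 PASS as INSTRUMENT + LOCATED LAW; no door)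

LANDING NOTE (typer ls-idea-typ-1 gen 2, 2026-08-28): the seat's `Sketch_WucLadder.lean` v1.1 (sha16
541c45c44077b1da, 226 l., rc 0) VERBATIM up to (i) namespace (`…Theorems.PrimeLevelFamEdgeIdeaDeltas.Wuc`),
(ii) the 0-ary rung `RootExpRung` made PARAMETRIC (`RootExpRung κ`, card instance `κ = 1`; typer rule: a
0-ary cited `Prop` in a Summits deck is relocated by the gate), (iii) docstrings/cite tags on every decl.
Everything marked PROVED is kernel-checked bookkeeping over tree theorems (Siegel, Tatuzawa, the class-number
repulsion theorem); the OPEN rungs are `def`s, NOT claims.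

# `wuc` lens (ls-idea-lens-13): the weakest-unknown-consequence LADDER under the leaf
`Zhang2022.Skeleton.LOneLowerBound A` — typed, two rails.

* ∃-RAIL (Prop-level, constants hidden): `LOneShape g` = "∃ c > 0, c·g(D) < ‖L(1,χ_D)‖ for every real
  primitive χ mod D ≥ 3".  The leaf is the shape `g = (log D)^{-A}` (`lOneShape_log_iff`).  FLOOR: every
  POWER shape `g = D^{-ε}` is a TREE THEOREM (Siegel, ineffective; `lOneShape_rpow_neg`), so on this rail
  the only rungs strictly between "known" and the leaf are SUB-POWER shapes `g = D^{-o(1)}`, e.g. the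
  root-exponential rung `g = exp(-√log D)` (`RootExpRung`, OPEN even ineffectively); `S → C` recorded
  (`rootExpRung_of_lOneLowerBound`).
* EXPLICIT RAIL (effectivity made kernel-visible by numerals): `LOneExplicit g D₀` = "g(D) ≤ ‖L(1,χ_D)‖
  for every real primitive χ mod D ≥ D₀" with NO existential.  Printed floor = Goldfeld–Gross–Zagier–Oesterlé
  ((log D)^{1-ε}/√D); every explicit rung above it is open, the weakest being `(log D)^{1+δ}/(K√D)`
  (`GGZPlusRung`), then Tatuzawa-without-its-exception (`TatuzawaNoException ε`; the tree PROVES it off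
  ONE modulus: `tatuzawaNoException_off_one`), …, up to the explicit leaf `LOneLowerBoundExplicit c₁ A`
  (which implies the ∃-leaf: `lOneLowerBound_of_explicit`).  On this rail `S_explicit → C` is
  `lOneExplicit_mono`; the ∃-leaf does NOT imply any explicit rung (effectivity gap, by design).
* h-CURRENCY: `ClassNumberLogPowRung κ K D₀` = "(log D)^κ / K ≤ h(−D)", read against the KERNEL repulsion
  theorem `classNumber_lt_of_realZero_sq` (a certified class-number floor at d excludes real zeros
  β with 1.24(1−β)²d ≤ floor): `noRealZero_of_classNumberRung`.

Nothing here is an exceptional-zero theorem; typed ≠ proved; the OPEN rungs are `def`s, not claims.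
-/

noncomputable section

namespace Summit.Parity.GeneralizedHardyLittlewood.Theorems.PrimeLevelFamEdgeIdeaDeltas.Wuc

open Literature.NumberTheory.LFunctions.Zhang2022.Skeleton
open Literature.NumberTheory.LFunctions.Siegel Literature.NumberTheory.LFunctions.Estermann
open Literature.NumberTheory.QuadraticFields

/-! ## ∃-rail -/

/-- ∃-rail rung of shape `g`: `∃ c > 0, c·g(D) < ‖L(1,χ)‖` for every real primitive `χ` mod `D ≥ 3`. [cite: Zhang2022LandauSiegel, §1 Theorem 1 (shape)] -/
def LOneShape (g : ℕ → ℝ) : Prop :=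
  ∃ c : ℝ, 0 < c ∧ ∀ (D : ℕ) [NeZero D] (χ : DirichletCharacter ℂ D),
    3 ≤ D → χ.IsQuadratic → χ.IsPrimitive → c * g D < ‖χ.LFunction 1‖

/-- `log D ≥ 1` for `D ≥ 3`. [folklore] -/
private theorem one_le_log_of_three_le {D : ℕ} (hD : 3 ≤ D) : (1 : ℝ) ≤ Real.log D := by
  have h3 : (3 : ℝ) ≤ D := by exact_mod_cast hD
  have he : Real.exp 1 ≤ (D : ℝ) := le_trans (le_of_lt (lt_trans Real.exp_one_lt_d9 (by norm_num))) h3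
  calc (1 : ℝ) = Real.log (Real.exp 1) := (Real.log_exp 1).symm
    _ ≤ Real.log D := Real.log_le_log (Real.exp_pos 1) he

/-- The leaf IS the shape `g = (log D)^{-A}`. [cite: Zhang2022LandauSiegel, §1 Theorem 1] -/
theorem lOneShape_log_iff (A : ℕ) :
    LOneShape (fun D => (Real.log D ^ A)⁻¹) ↔ LOneLowerBound A := by
  constructor
  · rintro ⟨c, hc, h⟩
    exact ⟨c, hc, fun D _ χ hD hq hp => by simpa [div_eq_mul_inv] using h D χ hD hq hp⟩
  · rintro ⟨c, hc, h⟩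
    exact ⟨c, hc, fun D _ χ hD hq hp => by simpa [div_eq_mul_inv] using h D χ hD hq hp⟩

/-- **S → C (BC2 converse, recorded):** the leaf implies every shape `g` with `g(D)(log D)^A` bounded. [cite: Zhang2022LandauSiegel, §1 Theorem 1] -/
theorem lOneShape_of_lOneLowerBound {A : ℕ} {g : ℕ → ℝ}
    (hg : ∃ K : ℝ, 0 < K ∧ ∀ D : ℕ, 3 ≤ D → g D * Real.log D ^ A ≤ K)
    (h : LOneLowerBound A) : LOneShape g := by
  obtain ⟨K, hK, hgK⟩ := hg
  obtain ⟨c₁, hc₁, h⟩ := h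
  refine ⟨c₁ / K, div_pos hc₁ hK, fun D _ χ hD hq hp => lt_of_le_of_lt ?_ (h D χ hD hq hp)⟩
  have hlog : 0 < Real.log D ^ A := pow_pos (lt_of_lt_of_le one_pos (one_le_log_of_three_le hD)) A
  have h1 : g D ≤ K / Real.log D ^ A := by
    rw [le_div_iff₀ hlog]; exact hgK D hD
  calc c₁ / K * g D ≤ c₁ / K * (K / Real.log D ^ A) :=
        mul_le_mul_of_nonneg_left h1 (div_pos hc₁ hK).le
    _ = c₁ / Real.log D ^ A := by field_simp

/-- Shapes are monotone: a pointwise smaller nonneg… no sign needed — if `g' ≤ g` pointwise then the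
`g`-rung gives the `g'`-rung (same constant). [cite: Zhang2022LandauSiegel, §1 Theorem 1 (shape)] -/
theorem lOneShape_mono {g g' : ℕ → ℝ} (hgg : ∀ D : ℕ, 3 ≤ D → g' D ≤ g D) (h : LOneShape g) :
    LOneShape g' := by
  obtain ⟨c, hc, h⟩ := h
  exact ⟨c, hc, fun D _ χ hD hq hp =>
    lt_of_le_of_lt (mul_le_mul_of_nonneg_left (hgg D hD) hc.le) (h D χ hD hq hp)⟩

/-- **FLOOR of the ∃-rail (Siegel, PROVED in tree, ineffective):** every power shape `D^{-ε}` holds.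
So no `∃ c`-typed power-or-weaker statement is a crux (BC4/BC7 would close it `crux.in-tree`). [cite: MontgomeryVaughan2007, Thm. 11.14 (Siegel)] -/
theorem lOneShape_rpow_neg {ε : ℝ} (hε : 0 < ε) : LOneShape (fun D => (D : ℝ) ^ (-ε)) := by
  obtain ⟨C, hC, h⟩ := siegel_theorem_primitive hε
  refine ⟨C / 2, half_pos hC, fun D _ χ hD hq hp => ?_⟩
  have hne : χ ≠ 1 := ne_one_of_isPrimitive_of_three_le hp hD
  have hsq : χ ^ 2 = 1 := hq.sq_eq_one
  have hpow : 0 < (D : ℝ) ^ (-ε) := Real.rpow_pos_of_pos (by exact_mod_cast NeZero.pos D) _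
  calc C / 2 * (D : ℝ) ^ (-ε) < C * (D : ℝ) ^ (-ε) := by
        apply mul_lt_mul_of_pos_right _ hpow; linarith
    _ ≤ (χ.LFunction 1).re := h D χ hsq hp hne
    _ ≤ ‖χ.LFunction 1‖ := Complex.re_le_norm _

/-- **The canonical sub-power rung (OPEN, even ineffectively): root-exponential decay at rate `κ`**,
`∃ c > 0, c·exp(−κ√log D) < ‖L(1,χ_D)‖` — for `κ > 0` strictly between Siegel's floor (`D^{-ε}` ∀ε) and
the leaf; the card's rung is `κ = 1`. PARAMETRIC in `κ` (typer rule), a `def`, NOT a claim.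
[cite: MontgomeryVaughan2007, Thm. 11.14 (Siegel) (context: every power shape is known)] -/
def RootExpRung (κ : ℝ) : Prop := LOneShape (fun D => Real.exp (-(κ * Real.sqrt (Real.log D))))

/-- General sub-power rungs `g_θ(D) = exp(−(log D)^θ)`, `0 < θ < 1` (θ = 1/2 is `RootExpRung` up to
`Real.sqrt` vs `rpow`). [cite: MontgomeryVaughan2007, Thm. 11.14 (context)] -/
def SubPowerRung (θ : ℝ) : Prop :=
  0 < θ ∧ θ < 1 ∧ LOneShape (fun D => Real.exp (-(Real.log D) ^ θ))

/-- Divisor-loss threshold rung `g(D) = exp(−C·log D/log log D)` (the weakest sub-power shape that still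
pays a divisor-function loss `τ(n) ≤ D^{O(1/log log D)}`), `D ≥ 16` so that `log log D > 1`. [cite: MontgomeryVaughan2007, Thm. 11.14 (context)] -/
def DivisorLossRung (C : ℝ) : Prop :=
  0 < C ∧ LOneShape (fun D => Real.exp (-(C * Real.log D / Real.log (Real.log D))))

/-- `u^{2A} e^{-u} ≤ (2A)!` for `u ≥ 0`, the domination behind `S → RootExpRung`. [folklore] -/
theorem pow_mul_exp_neg_le_factorial (A : ℕ) {u : ℝ} (hu : 0 ≤ u) :
    u ^ (2 * A) * Real.exp (-u) ≤ (2 * A).factorial := by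
  have h := Real.pow_div_factorial_le_exp (x := u) hu (2 * A)
  have hf : (0 : ℝ) < (2 * A).factorial := by exact_mod_cast Nat.factorial_pos _
  rw [div_le_iff₀ hf] at h
  rw [Real.exp_neg]
  have he : 0 < Real.exp u := Real.exp_pos u
  calc u ^ (2 * A) * (Real.exp u)⁻¹ = u ^ (2 * A) / Real.exp u := by rw [div_eq_mul_inv]
    _ ≤ Real.exp u * (2 * A).factorial / Real.exp u := by gcongr
    _ = (2 * A).factorial := by field_simp

/-- **S → C for the root-exponential rung** (the recorded BC2 converse): the leaf with ANY exponent `A`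
implies `RootExpRung`.  (`C → S` is open: that is the point of the rung.) [cite: Zhang2022LandauSiegel, §1 Theorem 1] -/
theorem rootExpRung_of_lOneLowerBound {A : ℕ} (h : LOneLowerBound A) : RootExpRung 1 := by
  unfold RootExpRung
  simp only [one_mul]
  refine lOneShape_of_lOneLowerBound ⟨(2 * A).factorial, by exact_mod_cast Nat.factorial_pos _, ?_⟩ h
  intro D hD
  have hlog : 0 ≤ Real.log D := le_trans zero_le_one (one_le_log_of_three_le hD)
  have hu : 0 ≤ Real.sqrt (Real.log D) := Real.sqrt_nonneg _
  have hsq : Real.log D = Real.sqrt (Real.log D) ^ 2 := (Real.sq_sqrt hlog).symm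
  calc Real.exp (-Real.sqrt (Real.log D)) * Real.log D ^ A
        = Real.sqrt (Real.log D) ^ (2 * A) * Real.exp (-Real.sqrt (Real.log D)) := by
          rw [mul_comm, pow_mul, ← hsq]
    _ ≤ (2 * A).factorial := pow_mul_exp_neg_le_factorial A hu

/-! ## Explicit rail (effectivity visible through numerals; no existential) -/

/-- Explicit rung of shape `g` from `D₀` on: `g(D) ≤ ‖L(1,χ)‖` for every real primitive `χ` mod `D ≥ D₀`.
Every constant is on the table; a single `D` refutes it; no `∃`. [cite: Zhang2022LandauSiegel, §1 Theorem 1 («effectively computable»)] -/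
def LOneExplicit (g : ℕ → ℝ) (D₀ : ℕ) : Prop :=
  ∀ (D : ℕ) [NeZero D] (χ : DirichletCharacter ℂ D),
    D₀ ≤ D → χ.IsQuadratic → χ.IsPrimitive → g D ≤ ‖χ.LFunction 1‖

/-- `S_explicit → C` on the explicit rail (proved): a pointwise smaller shape from a later threshold is
implied. [cite: Zhang2022LandauSiegel, §1 Theorem 1 (shape)] -/
theorem lOneExplicit_mono {g g' : ℕ → ℝ} {D₀ D₀' : ℕ} (hD : D₀ ≤ D₀')
    (hgg : ∀ D : ℕ, D₀' ≤ D → g' D ≤ g D) (h : LOneExplicit g D₀) : LOneExplicit g' D₀' :=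
  fun D _ χ hD' hq hp => le_trans (hgg D hD') (h D χ (le_trans hD hD') hq hp)

/-- The EXPLICIT leaf: Zhang's Theorem 1 "as printed, effective" with the constant exposed. [cite: Zhang2022LandauSiegel, §1 Theorem 1] -/
def LOneLowerBoundExplicit (c₁ : ℝ) (A : ℕ) : Prop :=
  LOneExplicit (fun D => c₁ / Real.log D ^ A) 3

/-- Explicit leaf ⇒ ∃-leaf (the converse extraction of a numeral from `∃ c₁` is impossible in principle:
that is the effectivity gap the two rails make kernel-visible). [cite: Zhang2022LandauSiegel, §1 Theorem 1] -/
theorem lOneLowerBound_of_explicit {c₁ : ℝ} {A : ℕ} (hc : 0 < c₁) (h : LOneLowerBoundExplicit c₁ A) :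
    LOneLowerBound A := by
  refine ⟨c₁ / 2, half_pos hc, fun D _ χ hD hq hp => lt_of_lt_of_le ?_ (h D χ hD hq hp)⟩
  have hlog : 0 < Real.log D ^ A := pow_pos (lt_of_lt_of_le one_pos (one_le_log_of_three_le hD)) A
  exact div_lt_div_of_pos_right (by linarith) hlog

/-- **Weakest explicit rung above the printed floor (OPEN):** `(log D)^{1+δ}/(K·√D) ≤ ‖L(1,χ_D)‖`,
`D ≥ D₀` — just above Goldfeld–Gross–Zagier–Oesterlé (`(log D)·∏(…)/(55√D)·π`-type, exponent `1−ε`). [cite: MontgomeryVaughan2007, §11.2 (Goldfeld–Gross–Zagier, context)] -/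
def GGZPlusRung (δ K : ℝ) (D₀ : ℕ) : Prop :=
  0 ≤ δ ∧ 0 < K ∧ LOneExplicit (fun D => Real.log D ^ (1 + δ) / (K * Real.sqrt D)) D₀

/-- **The weakest open explicit rung (referee B, b78 (3)): exponent EXACTLY 1 with a UNIFORM constant,**
`(log D)/(K √D) ≤ ‖L(1,χ_D)‖` for all `D ≥ D₀` — GGZ–Oesterlé's `(log D)·∏_{p∣D}(1 − [2√p]/(p+1))`
degrades with `ω(D)`; combined with genus theory `h ≥ 2^{ω(D)−1}` the known uniform form is only
`(log D)^{1−o(1)}`. h-twin: `h(−D) ≥ (log D)/(πK)`. [cite: MontgomeryVaughan2007, §11.2 (Goldfeld–Gross–Zagier, context)] -/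
def GGZUniformRung (K : ℝ) (D₀ : ℕ) : Prop := GGZPlusRung 0 K D₀

/-- Unfolding of the uniform rung (proved). [cite: MontgomeryVaughan2007, §11.2 (the Goldfeld–Gross–Zagier lower bound, context)] -/
theorem ggzUniformRung_iff (K : ℝ) (D₀ : ℕ) :
    GGZUniformRung K D₀ ↔
      0 < K ∧ LOneExplicit (fun D => Real.log D / (K * Real.sqrt D)) D₀ := by
  unfold GGZUniformRung GGZPlusRung
  simp only [le_refl, true_and, add_zero, Real.rpow_one]

/-- Monotonicity in δ on `D ≥ 3` (log D ≥ 1): a larger exponent is a STRONGER rung. [cite: MontgomeryVaughan2007, §11.2 (context)] -/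
theorem ggzPlusRung_mono {δ δ' K : ℝ} {D₀ : ℕ} (hδ : 0 ≤ δ) (hδδ' : δ ≤ δ') (hD₀ : 3 ≤ D₀)
    (h : GGZPlusRung δ' K D₀) : GGZPlusRung δ K D₀ := by
  rcases h with ⟨_, hK, h⟩
  refine ⟨hδ, hK, ?_⟩
  refine lOneExplicit_mono le_rfl (fun D hD => ?_) h
  have hD3 : (3 : ℕ) ≤ D := le_trans hD₀ hD
  have hlog : 1 ≤ Real.log D := one_le_log_of_three_le hD3
  have hsqrt : 0 < K * Real.sqrt D := by
    have : (0:ℝ) < D := by exact_mod_cast (show 0 < D by omega)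
    positivity
  exact div_le_div_of_nonneg_right (Real.rpow_le_rpow_of_exponent_le hlog (by linarith)) hsqrt.le

/-- **Explicit power rung = Tatuzawa WITHOUT its exception (OPEN for every ε < 1/2):** the tree's
explicit Tatuzawa constant `C_T ε³ q^{-ε}`, demanded at EVERY modulus. [cite: Tatuzawa1951, Theorem 2] -/
def TatuzawaNoException (ε : ℝ) : Prop :=
  ∀ (q : ℕ) [NeZero q] (χ : DirichletCharacter ℂ q), χ ^ 2 = 1 → χ.IsPrimitive → χ ≠ 1 →
    estermannC / (2592 * ballConst) * ε ^ 3 * (q : ℝ) ^ (-ε) ≤ (χ.LFunction 1).re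

/- KERNEL FACT (tree): `Literature.NumberTheory.LFunctions.Siegel.tatuzawa_atMostOne_modulus` proves the
explicit power rung OFF ONE modulus — the whole open content of `TatuzawaNoException ε` is that one modulus
(= the Siegel zero). Not restated here (typer dedup rule): import `TatuzawaTheorem` and cite it. -/

/- (Remark.) `LOneLowerBoundExplicit c₁ A → TatuzawaNoException ε` holds whenever the numerals dominate
pointwise (`C_T ε³ D^{-ε} ≤ c₁ (log D)^{-A}` for `D ≥ 3`) — routine once `‖L(1,χ)‖ = Re L(1,χ)` for real χ
is invoked; not typed here (TYP-1 may add it as `S_explicit → C`). -/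

/-! ## h-currency: explicit class-number rungs, read against the kernel repulsion theorem -/

/-- Explicit class-number rung: `(log D)^κ / K ≤ h(−D)` for every `D ≥ D₀` with `−D` a (form)
discriminant.  κ = 1 (with Oesterlé's product) is GGZ; κ = 2, K = 30 is the first open explicit rung
("h(−D) ≥ (log D)²/30"), certified in print for every fundamental D below Watkins' h ≤ 100 range. [cite: MontgomeryVaughan2007, §11.2 (context)] -/
def ClassNumberLogPowRung (κ : ℕ) (K : ℝ) (D₀ : ℕ) : Prop :=
  0 < K ∧ ∀ D : ℕ, D₀ ≤ D → ((-(D : ℤ)) % 4 = 0 ∨ (-(D : ℤ)) % 4 = 1) →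
    Real.log D ^ κ / K ≤ (BinaryQuadraticForm.classNumber (-(D : ℤ)) : ℝ)

/-- **Kernel reading of an h-rung (no new mathematics: `classNumber_lt_of_realZero_sq` contraposed):**
a certified floor `F ≤ h(−d)` at an odd real primitive character mod `d > 4` excludes every real zero
`β ∈ [9/10, 1)` with `1.24(1−β)²d ≤ F` — i.e. the h-rung `(log d)^κ/K` is a zero-free interval
`[1 − (log d)^{κ/2}/√(1.24 K d), 1)` (GGZ scale for κ = 1,2). [folklore] -/
theorem noRealZero_of_classNumberFloor {d : ℕ} [NeZero d] (hd : 4 < d)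
    {χ : DirichletCharacter ℂ d} (hprim : χ.IsPrimitive) (hquad : χ.IsQuadratic) (hodd : χ.Odd)
    {F : ℝ} (hF : F ≤ (BinaryQuadraticForm.classNumber (-(d : ℤ)) : ℝ))
    {β : ℝ} (hβ9 : 9 / 10 ≤ β) (hβ1 : β < 1) (hrep : 1.24 * (1 - β) ^ 2 * (d : ℝ) ≤ F) :
    χ.LFunction β ≠ 0 := by
  intro hz
  have h := Literature.NumberTheory.LFunctions.ClassSumRepulsion.classNumber_lt_of_realZero_sq hd hprim hquad hodd hβ9 hβ1 hz
  linarith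

end Summit.Parity.GeneralizedHardyLittlewood.Theorems.PrimeLevelFamEdgeIdeaDeltas.Wuc
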